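import Summits.QuantumFields.YangMills.Theorems.BalabanLadderNTSkewResponseCoupling
import Summits.QuantumFields.YangMills.Theorems.BalabanLadderIRAfOnsetCovariance
import Summits.QuantumFields.YangMills.Theorems.LangevinControlUVOSLegsFromFemtoAndGapStubAssemblyMomentWeights
import Summits.QuantumFields.YangMills.Theorems.BalabanLadderUVSeamRecResponseMomentsPinning
import Summits.QuantumFields.YangMills.Theorems.CurvatureBoostCovariance.Negative.BetaZeroMoments
import Mathlib.MeasureTheory.Integral.IntervalIntegral.FundThmCalculus
import Mathlib.Analysis.Calculus.Deriv.MeanValue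
import HarnessLib

/-!
# Crux `NT` (stmt-QuantumFields-19353): the ZERO-MOMENTUM SUM RULE for clause (i)'s two-point object — sign, monotonicity of
# the one-point function in the coupling, and a volume-uniform β-budget at weak coupling (hypothesis-free)

Helper file of the fleet lead prover of crux `NT` (unit `ym-spine-19353-p1`, g8); general compact `G`, any lattice
representation `r`, every odd torus `2L+1`; nothing of the chain is assumed.

Clause (i) of `LowerBounds G r a` floors `Q2_{β,L,a(β)}(θv, v) = Σ_{x,y} θv(a x) v(a y) Cov_T(A_x, A_y)`, `A_x = dens x` the action
density.  Its zero mode is the per-site SUSCEPTIBILITY `χ_L(β; x) := Σ_{z ∈ box L} Cov_{T,β}(A_x, A_z)` (the box is a fundamental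
domain of the torus).  Using the tree's coupling derivative (`SkewResponse.hasDerivAt_torusE_coupling`: `∂_β E_T[F] = Cov_T(F, −S_W)`)
and the dictionary `Σ_{z ∈ box L} A_z ∘ lift = 6 N (2L+1)⁴ − S_W` (the action density summed over a fundamental domain IS the
Wilson action up to sign and a constant), this file proves:

* §1 `sum_box_comp_proj`, `sum_box_dens_torusLift` — the dictionary.
* §2 **`hasDerivAt_torusE_dens_coupling`** — the sum rule `∂_β E_{T,β}[A_x] = χ_L(β; x)` (exact, every `β`, `L`, `x`);
  `sum_torusCov_dens_eq` (`χ_L(β; x) = Var_{T,β}(S_W)/(2L+1)⁴`, the same for every `x`) and **`sum_torusCov_dens_nonneg`** (`χ_L ≥ 0`);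
  `torusE_dens_monotone` — the one-point function `β ↦ E_{T,β}[A_x]` is non-decreasing (the mean plaquette energy is non-increasing:
  the tree's `wilsonExpectation_wilsonAction_antitone` read in the route's letters).
* `integral_sum_torusCov_dens_eq` — the integrated sum rule `∫_{β₁}^{β₂} χ_L(γ; x) dγ = E_{T,β₂}[A_x] − E_{T,β₁}[A_x]`.
  The sequel `Theorems/BalabanLadderNTCouplingSumRuleBudget` adds the weak-coupling β-budget (uniformly in the volume, from the
  tree's chessboard moments): `6N − E_{T,β}[A_x] ≤ 6K(1 + log β)/β`, `∫_{β₁}^{β₂} χ_L ≤ 6K(1 + log β₁)/β₁`, and a coupling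
  `γ ∈ [β, 2β]` with `χ_L(γ; x) ≤ 6K(1 + log β)/β²`.

Reading (numbers): the zero-momentum two-point function of `tr_r F²` per site is non-negative, is the β-derivative of a bounded
monotone function, hence has β-integral `≤ 6N` over `[β₁, ∞)` on EVERY torus and obeys the perturbative `β⁻²` law (up to `1 + log β`)
on a set of couplings meeting every window `[β, 2β]`, uniformly in `L` — the rigorous, volume-uniform form of the route's
`why_might_fail` «fixed-order lattice PT gives Q2 ~ β⁻²» AT ZERO LATTICE MOMENTUM.  It says nothing at lattice momenta `|k| ≍ a(β)`,
where clause (i)'s witness lives; no floor, no decay in `|x − y|`, nothing of NT, the seam or the gap is claimed.  Not Clay.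

References: Friedli–Velenik (2017) §3.2 (convexity of the pressure); Seiler LNP 159 (1982) Ch. 2; Fröhlich–Israel–Lieb–Simon
CMP 62 (1978) (chessboard moments, via the tree).
-/

set_option autoImplicit false

noncomputable section

open MeasureTheory Filter Topology Finset
open scoped BigOperators
open Literature.MathematicalPhysics.QuantumFieldTheory hiding ZdEdge
open Literature.MathematicalPhysics.QuantumLattice
open Literature.Probability.LatticeModels (Site box mem_box card_box)
open Summit.QuantumFields.YangMills.Cruxes.OSLegsFromFemtoAndGap.DlrCollarTransfer
open Summit.QuantumFields.YangMills.Cruxes.OSLegsFromFemtoAndGap.DlrCollarTransfer.StubLower (exists_abs_dens_le)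
open Summit.QuantumFields.YangMills.Cruxes.UVSeamRec.ResponsePinning (integrable_comp_lift)
open Summit.QuantumFields.YangMills.Theorems.CurvatureBoostCovariance.Negative (card_planes)
open Summit.QuantumFields.YangMills.Theorems.OSLegsFromFemtoAndGap (torusE_dens_eq_wilsonTorusMean)
open Summit.QuantumFields.YangMills.Cruxes.IR.AfOnset (dens_torusLift_eq exists_plaquetteCost_moments_le
  integral_const_sub_mul_const_sub)
open Summit.QuantumFields.YangMills.Cruxes.NT.SkewResponse (hasDerivAt_torusE_coupling)
open Literature.MathematicalPhysics.QuantumFieldTheory.WilsonRP (plaqRe abs_plaqRe_le measurable_plaqRe)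

namespace Summit.QuantumFields.YangMills.Cruxes.NT.CouplingSumRule

/-! ## §1 Dictionary: a fundamental domain of the odd torus; the summed action density is the Wilson action -/

/-- **The box `[−L, L]⁴` is a fundamental domain of the torus `(ℤ/(2L+1))⁴`**: summing a function of the torus site over the
box (through `Torus.proj`) is summing it over the torus. [folklore] -/
theorem sum_box_comp_proj {α : Type*} [AddCommMonoid α] (L : ℕ) (g : (Fin 4 → ZMod (2 * L + 1)) → α) :
    ∑ z ∈ box 4 L, g (Literature.Probability.LatticeModels.Torus.proj (2 * L + 1) z) = ∑ s, g s := by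
  classical
  have hinj : Set.InjOn (Literature.Probability.LatticeModels.Torus.proj (d := 4) (2 * L + 1)) ↑(box 4 L) := by
    intro x hx y hy hxy
    refine Literature.Probability.LatticeModels.Torus.proj_injective_of_abs_sub_lt (fun j => ?_) hxy
    rw [Finset.mem_coe, mem_box] at hx hy
    have h1 := hx j
    have h2 := hy j
    rw [abs_lt]
    push_cast
    constructor <;> linarith [h1.1, h1.2, h2.1, h2.2]
  rw [← Finset.sum_image hinj]
  have huniv : (box 4 L).image (Literature.Probability.LatticeModels.Torus.proj (d := 4) (2 * L + 1)) = Finset.univ := by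
    apply Finset.eq_univ_of_card
    rw [Finset.card_image_of_injOn hinj, card_box, Fintype.card_pi, Finset.prod_const, ZMod.card, Finset.card_univ,
      Fintype.card_fin]
  rw [huniv]


section Main

variable (G : Type) [Group G] [TopologicalSpace G] [IsTopologicalGroup G] [CompactSpace G]
  [MeasurableSpace G] [BorelSpace G] (r : LatticeRep G)

/-- **Dictionary: the action density summed over a fundamental domain of the torus is `6N(2L+1)⁴ − S_W`.**  For every torus
configuration `U` of side `2L+1`: `Σ_{z ∈ box L} dens_z(lift U) = 6 N (2L+1)⁴ − S_W(U)` (`AfOnset.dens_torusLift_eq`: the density at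
`z` is `Σ_q (N − φ_{(z̄,q)})` over the six orientations; the box is a fundamental domain; `S_W = Σ_p φ_p`). [folklore] -/
theorem sum_box_dens_torusLift (L : ℕ) (U : GaugeConfig 4 (2 * L + 1) G) :
    ∑ z ∈ box 4 L, dens G r z (torusLift (2 * L + 1) U) =
      6 * (r.N : ℝ) * ((2 * L + 1 : ℕ) : ℝ) ^ 4 - wilsonAction (d := 4) (L := 2 * L + 1) r.ρ U := by
  classical
  simp_rw [dens_torusLift_eq]
  rw [sum_box_comp_proj L (fun s => ∑ q : {q : Fin 4 × Fin 4 // q.1 < q.2},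
    ((r.N : ℝ) - plaquetteCost r.ρ U (s, q)))]
  have hS : wilsonAction (d := 4) (L := 2 * L + 1) r.ρ U =
      ∑ s : Fin 4 → ZMod (2 * L + 1), ∑ q : {q : Fin 4 × Fin 4 // q.1 < q.2}, plaquetteCost r.ρ U (s, q) := by
    rw [← Fintype.sum_prod_type']
    rfl
  rw [hS]
  simp only [Finset.sum_sub_distrib, Finset.sum_const, Finset.card_univ, card_planes, Fintype.card_pi,
    Finset.prod_const, ZMod.card, Fintype.card_fin]
  push_cast
  ring

/-! ## §2 The zero-momentum sum rule, its sign, monotonicity of the one-point function -/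

/-- **Zero-momentum sum rule.**  For every `β`, `L`, `x`:
`∂_β E_{T,β}[A_x] = Σ_{z ∈ box L} Cov_{T,β}(A_x, A_z)` — the coupling derivative of the one-point function of the action density is
its zero-momentum two-point function per site (the susceptibility `χ_L(β; x)`).  `SkewResponse.hasDerivAt_torusE_coupling` with
`−S_W = Σ_z A_z∘lift − 6N(2L+1)⁴`; constants do not contribute to covariances. [folklore] -/
theorem hasDerivAt_torusE_dens_coupling (β : ℝ) (L : ℕ) (x : Fin 4 → ℤ) :
    HasDerivAt (fun β' => torusE G r β' L (dens G r x))
      (∑ z ∈ box 4 L, (torusE G r β L (fun U => dens G r x U * dens G r z U) -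
        torusE G r β L (dens G r x) * torusE G r β L (dens G r z))) β := by
  haveI := r.secondCountableTopology
  haveI := isProbabilityMeasure_wilsonMeasure (d := 4) (L := 2 * L + 1) r.ρ r.continuous β
  obtain ⟨M, -, hM⟩ := exists_abs_dens_le G r
  have hd := hasDerivAt_torusE_coupling G r β L (continuous_dens r x) (hM x)
  refine hd.congr_deriv ?_
  set μ := wilsonMeasure (d := 4) (L := 2 * L + 1) r.ρ β with hμ
  set C : ℝ := 6 * (r.N : ℝ) * ((2 * L + 1 : ℕ) : ℝ) ^ 4 with hC
  have hS : ∀ U : GaugeConfig 4 (2 * L + 1) G, -wilsonAction (d := 4) (L := 2 * L + 1) r.ρ U =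
      (∑ z ∈ box 4 L, dens G r z (torusLift (2 * L + 1) U)) - C := by
    intro U; rw [sum_box_dens_torusLift]; ring
  simp_rw [hS]
  have iD : ∀ z, Integrable (fun U : GaugeConfig 4 (2 * L + 1) G => dens G r z (torusLift (2 * L + 1) U)) μ :=
    fun z => integrable_comp_lift r β L (continuous_dens r z)
  have iDD : ∀ z, Integrable (fun U : GaugeConfig 4 (2 * L + 1) G =>
      dens G r x (torusLift (2 * L + 1) U) * dens G r z (torusLift (2 * L + 1) U)) μ :=
    fun z => integrable_comp_lift r β L (F := fun V => dens G r x V * dens G r z V)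
      ((continuous_dens r x).mul (continuous_dens r z))
  have e1 : ∫ U, dens G r x (torusLift (2 * L + 1) U) *
        ((∑ z ∈ box 4 L, dens G r z (torusLift (2 * L + 1) U)) - C) ∂μ =
      (∑ z ∈ box 4 L, ∫ U, dens G r x (torusLift (2 * L + 1) U) * dens G r z (torusLift (2 * L + 1) U) ∂μ) -
        C * ∫ U, dens G r x (torusLift (2 * L + 1) U) ∂μ := by
    have hpt : (fun U : GaugeConfig 4 (2 * L + 1) G => dens G r x (torusLift (2 * L + 1) U) *
          ((∑ z ∈ box 4 L, dens G r z (torusLift (2 * L + 1) U)) - C)) =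
        fun U => (∑ z ∈ box 4 L, dens G r x (torusLift (2 * L + 1) U) * dens G r z (torusLift (2 * L + 1) U)) -
          C * dens G r x (torusLift (2 * L + 1) U) := by
      funext U; rw [mul_sub, Finset.mul_sum]; ring
    rw [hpt, integral_sub (integrable_finsetSum _ fun z _ => iDD z) ((iD x).const_mul C),
      integral_finsetSum _ (fun z _ => iDD z), integral_const_mul]
  have e2 : ∫ U, ((∑ z ∈ box 4 L, dens G r z (torusLift (2 * L + 1) U)) - C) ∂μ =
      (∑ z ∈ box 4 L, ∫ U, dens G r z (torusLift (2 * L + 1) U) ∂μ) - C := by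
    rw [integral_sub (integrable_finsetSum _ fun z _ => iD z) (integrable_const C),
      integral_finsetSum _ (fun z _ => iD z), integral_const, probReal_univ, one_smul]
  rw [e1, e2]
  unfold torusE
  rw [Finset.sum_sub_distrib, mul_sub, Finset.mul_sum]
  ring

/-- **The susceptibility does not depend on the site**: `Σ_z Cov_T(A_x, A_z) = Σ_z Cov_T(A_y, A_z)` — both are the coupling
derivative of the same function, the torus one-point function being translation invariant
(`torusE_dens_eq_wilsonTorusMean`). [folklore] -/
theorem sum_torusCov_dens_eq_of_site (β : ℝ) (L : ℕ) (x y : Fin 4 → ℤ) :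
    ∑ z ∈ box 4 L, (torusE G r β L (fun U => dens G r x U * dens G r z U) -
        torusE G r β L (dens G r x) * torusE G r β L (dens G r z)) =
      ∑ z ∈ box 4 L, (torusE G r β L (fun U => dens G r y U * dens G r z U) -
        torusE G r β L (dens G r y) * torusE G r β L (dens G r z)) := by
  have hx := hasDerivAt_torusE_dens_coupling G r β L x
  have hy := hasDerivAt_torusE_dens_coupling G r β L y
  have hfun : (fun β' => torusE G r β' L (dens G r x)) = fun β' => torusE G r β' L (dens G r y) := by
    funext β'
    rw [torusE_dens_eq_wilsonTorusMean, torusE_dens_eq_wilsonTorusMean]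
  rw [hfun] at hx
  exact hx.unique hy

/-- **Summed over the fundamental domain, the susceptibilities give the variance of the Wilson action**:
`Σ_{x ∈ box L} Σ_{z ∈ box L} Cov_T(A_x, A_z) = Var_{T,β}(S_W)` (bilinearity; `Σ_x A_x∘lift = 6N(2L+1)⁴ − S_W`). [folklore] -/
theorem sum_sum_torusCov_dens_eq_var (β : ℝ) (L : ℕ) :
    ∑ x ∈ box 4 L, ∑ z ∈ box 4 L, (torusE G r β L (fun U => dens G r x U * dens G r z U) -
        torusE G r β L (dens G r x) * torusE G r β L (dens G r z)) =
      (∫ U, wilsonAction (d := 4) (L := 2 * L + 1) r.ρ U * wilsonAction (d := 4) (L := 2 * L + 1) r.ρ U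
          ∂(wilsonMeasure (d := 4) (L := 2 * L + 1) r.ρ β)) -
        (∫ U, wilsonAction (d := 4) (L := 2 * L + 1) r.ρ U ∂(wilsonMeasure (d := 4) (L := 2 * L + 1) r.ρ β)) *
          (∫ U, wilsonAction (d := 4) (L := 2 * L + 1) r.ρ U ∂(wilsonMeasure (d := 4) (L := 2 * L + 1) r.ρ β)) := by
  haveI := r.secondCountableTopology
  haveI := isProbabilityMeasure_wilsonMeasure (d := 4) (L := 2 * L + 1) r.ρ r.continuous β
  set μ := wilsonMeasure (d := 4) (L := 2 * L + 1) r.ρ β with hμ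
  set C : ℝ := 6 * (r.N : ℝ) * ((2 * L + 1 : ℕ) : ℝ) ^ 4 with hC
  have iD : ∀ z, Integrable (fun U : GaugeConfig 4 (2 * L + 1) G => dens G r z (torusLift (2 * L + 1) U)) μ :=
    fun z => integrable_comp_lift r β L (continuous_dens r z)
  have iDD : ∀ x z, Integrable (fun U : GaugeConfig 4 (2 * L + 1) G =>
      dens G r x (torusLift (2 * L + 1) U) * dens G r z (torusLift (2 * L + 1) U)) μ :=
    fun x z => integrable_comp_lift r β L (F := fun V => dens G r x V * dens G r z V)
      ((continuous_dens r x).mul (continuous_dens r z))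
  obtain ⟨B, hB⟩ := exists_abs_wilsonAction_le (d := 4) (L := 2 * L + 1) r.ρ r.continuous
  have hSm : Measurable (wilsonAction (d := 4) (L := 2 * L + 1) (G := G) r.ρ) :=
    measurable_wilsonAction (d := 4) (L := 2 * L + 1) r.ρ r.continuous
  have iS : Integrable (wilsonAction (d := 4) (L := 2 * L + 1) (G := G) r.ρ) μ := integrable_of_abs_le hSm hB
  have iSS : Integrable (fun U => wilsonAction (d := 4) (L := 2 * L + 1) (G := G) r.ρ U *
      wilsonAction (d := 4) (L := 2 * L + 1) r.ρ U) μ := by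
    refine integrable_of_abs_le (hSm.mul hSm) (C := B * B) fun U => ?_
    rw [abs_mul]
    exact mul_le_mul (hB U) (hB U) (abs_nonneg _) ((abs_nonneg _).trans (hB U))
  -- the summed density is `C − S_W`
  have hsum : ∀ U : GaugeConfig 4 (2 * L + 1) G, (∑ z ∈ box 4 L, dens G r z (torusLift (2 * L + 1) U)) =
      C - wilsonAction (d := 4) (L := 2 * L + 1) r.ρ U := fun U => by
    rw [sum_box_dens_torusLift]
  -- bilinearity
  have e1 : ∑ x ∈ box 4 L, ∑ z ∈ box 4 L, torusE G r β L (fun U => dens G r x U * dens G r z U) =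
      ∫ U, (C - wilsonAction (d := 4) (L := 2 * L + 1) r.ρ U) * (C - wilsonAction (d := 4) (L := 2 * L + 1) r.ρ U) ∂μ := by
    unfold torusE
    simp_rw [← hsum, Finset.sum_mul_sum]
    rw [integral_finsetSum _ (fun x _ => integrable_finsetSum _ fun z _ => iDD x z)]
    refine Finset.sum_congr rfl fun x _ => ?_
    rw [integral_finsetSum _ (fun z _ => iDD x z)]
  have e2 : ∑ x ∈ box 4 L, torusE G r β L (dens G r x) =
      ∫ U, (C - wilsonAction (d := 4) (L := 2 * L + 1) r.ρ U) ∂μ := by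
    unfold torusE
    simp_rw [← hsum]
    rw [integral_finsetSum _ (fun x _ => iD x)]
  have e3 : ∑ x ∈ box 4 L, ∑ z ∈ box 4 L, torusE G r β L (dens G r x) * torusE G r β L (dens G r z) =
      (∫ U, (C - wilsonAction (d := 4) (L := 2 * L + 1) r.ρ U) ∂μ) *
        ∫ U, (C - wilsonAction (d := 4) (L := 2 * L + 1) r.ρ U) ∂μ := by
    rw [← e2, Finset.sum_mul_sum]
  simp_rw [Finset.sum_sub_distrib]
  rw [e1, e3]
  exact integral_const_sub_mul_const_sub μ iS iS iSS C

/-- **The susceptibility is the variance of the Wilson action per site**: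
`Σ_{z ∈ box L} Cov_T(A_x, A_z) = Var_{T,β}(S_W)/(2L+1)⁴` for every `x`. [folklore] -/
theorem sum_torusCov_dens_eq (β : ℝ) (L : ℕ) (x : Fin 4 → ℤ) :
    ∑ z ∈ box 4 L, (torusE G r β L (fun U => dens G r x U * dens G r z U) -
        torusE G r β L (dens G r x) * torusE G r β L (dens G r z)) =
      ((∫ U, wilsonAction (d := 4) (L := 2 * L + 1) r.ρ U * wilsonAction (d := 4) (L := 2 * L + 1) r.ρ U
          ∂(wilsonMeasure (d := 4) (L := 2 * L + 1) r.ρ β)) -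
        (∫ U, wilsonAction (d := 4) (L := 2 * L + 1) r.ρ U ∂(wilsonMeasure (d := 4) (L := 2 * L + 1) r.ρ β)) *
          (∫ U, wilsonAction (d := 4) (L := 2 * L + 1) r.ρ U ∂(wilsonMeasure (d := 4) (L := 2 * L + 1) r.ρ β))) /
        ((2 * L + 1 : ℕ) : ℝ) ^ 4 := by
  have hvar := sum_sum_torusCov_dens_eq_var G r β L
  have hconst : ∑ x' ∈ box 4 L, ∑ z ∈ box 4 L, (torusE G r β L (fun U => dens G r x' U * dens G r z U) -
        torusE G r β L (dens G r x') * torusE G r β L (dens G r z)) =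
      ((2 * L + 1 : ℕ) : ℝ) ^ 4 * ∑ z ∈ box 4 L, (torusE G r β L (fun U => dens G r x U * dens G r z U) -
        torusE G r β L (dens G r x) * torusE G r β L (dens G r z)) := by
    rw [Finset.sum_congr rfl fun x' _ => sum_torusCov_dens_eq_of_site G r β L x' x, Finset.sum_const, card_box,
      nsmul_eq_mul]
    push_cast
    ring
  have hpos : (0 : ℝ) < ((2 * L + 1 : ℕ) : ℝ) ^ 4 := by positivity
  rw [eq_div_iff hpos.ne', ← hvar, hconst]
  ring

/-- **The zero-momentum two-point function is non-negative**: `0 ≤ Σ_{z ∈ box L} Cov_{T,β}(A_x, A_z)` for every `β`, `L`, `x`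
(it is a variance per site). [folklore] -/
theorem sum_torusCov_dens_nonneg (β : ℝ) (L : ℕ) (x : Fin 4 → ℤ) :
    0 ≤ ∑ z ∈ box 4 L, (torusE G r β L (fun U => dens G r x U * dens G r z U) -
        torusE G r β L (dens G r x) * torusE G r β L (dens G r z)) := by
  haveI := r.secondCountableTopology
  haveI := isProbabilityMeasure_wilsonMeasure (d := 4) (L := 2 * L + 1) r.ρ r.continuous β
  rw [sum_torusCov_dens_eq]
  refine div_nonneg ?_ (by positivity)
  obtain ⟨B, hB⟩ := exists_abs_wilsonAction_le (d := 4) (L := 2 * L + 1) r.ρ r.continuous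
  have hSm : Measurable (wilsonAction (d := 4) (L := 2 * L + 1) (G := G) r.ρ) :=
    measurable_wilsonAction (d := 4) (L := 2 * L + 1) r.ρ r.continuous
  have hBB : ∀ U : GaugeConfig 4 (2 * L + 1) G, |wilsonAction (d := 4) (L := 2 * L + 1) r.ρ U *
      wilsonAction (d := 4) (L := 2 * L + 1) r.ρ U| ≤ B * B := fun U => by
    rw [abs_mul]
    exact mul_le_mul (hB U) (hB U) (abs_nonneg _) ((abs_nonneg _).trans (hB U))
  set μ := wilsonMeasure (d := 4) (L := 2 * L + 1) r.ρ β with hμ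
  have iS : Integrable (wilsonAction (d := 4) (L := 2 * L + 1) (G := G) r.ρ) μ := integrable_of_abs_le hSm hB
  have iSS : Integrable (fun U => wilsonAction (d := 4) (L := 2 * L + 1) (G := G) r.ρ U *
      wilsonAction (d := 4) (L := 2 * L + 1) r.ρ U) μ := integrable_of_abs_le (hSm.mul hSm) hBB
  -- `Var S = ∫ (m − S)² ≥ 0` with `m = ∫ S`
  have hvar := integral_const_sub_mul_const_sub μ iS iS iSS (∫ V, wilsonAction (d := 4) (L := 2 * L + 1) r.ρ V ∂μ)
  have hz : ∫ U, ((∫ V, wilsonAction (d := 4) (L := 2 * L + 1) r.ρ V ∂μ) -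
      wilsonAction (d := 4) (L := 2 * L + 1) r.ρ U) ∂μ = 0 := by
    rw [integral_sub (integrable_const _) iS, integral_const, probReal_univ, one_smul, sub_self]
  rw [hz, mul_zero, sub_zero] at hvar
  rw [← hvar]
  exact integral_nonneg fun U => mul_self_nonneg _

/-- **The one-point function of the action density is non-decreasing in the coupling** on every odd torus:
`β ↦ E_{T,β}[A_x]` is monotone (`A = Σ_q Re tr_r U_q`; equivalently the mean plaquette energy is non-increasing — the tree's
`wilsonExpectation_wilsonAction_antitone` in the route's letters, here from the sum rule and its sign). [folklore] -/
theorem torusE_dens_monotone (L : ℕ) (x : Fin 4 → ℤ) : Monotone fun β => torusE G r β L (dens G r x) :=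
  monotone_of_deriv_nonneg (fun β => (hasDerivAt_torusE_dens_coupling G r β L x).differentiableAt) fun β => by
    rw [(hasDerivAt_torusE_dens_coupling G r β L x).deriv]
    exact sum_torusCov_dens_nonneg G r β L x

/-- `β ↦ E_{T,β}[F∘lift]` is continuous for every bounded continuous observable (it is differentiable,
`SkewResponse.hasDerivAt_torusE_coupling`). [folklore] -/
theorem continuous_torusE_coupling (L : ℕ) {F : LGConfig 4 G → ℝ} (hF : Continuous F) {M : ℝ} (hM : ∀ V, |F V| ≤ M) :
    Continuous fun β => torusE G r β L F :=
  continuous_iff_continuousAt.2 fun β => (hasDerivAt_torusE_coupling G r β L hF hM).continuousAt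

/-- The susceptibility `β ↦ Σ_z Cov_{T,β}(A_x, A_z)` is continuous in the coupling. [folklore] -/
theorem continuous_sum_torusCov_dens (L : ℕ) (x : Fin 4 → ℤ) :
    Continuous fun β => ∑ z ∈ box 4 L, (torusE G r β L (fun U => dens G r x U * dens G r z U) -
        torusE G r β L (dens G r x) * torusE G r β L (dens G r z)) := by
  obtain ⟨M, -, hM⟩ := exists_abs_dens_le G r
  have hMM : ∀ z (V : LGConfig 4 G), |dens G r x V * dens G r z V| ≤ M * M := fun z V => by
    rw [abs_mul]
    exact mul_le_mul (hM x V) (hM z V) (abs_nonneg _) ((abs_nonneg _).trans (hM x V))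
  refine continuous_finsetSum _ fun z _ => ?_
  exact (continuous_torusE_coupling G r L ((continuous_dens r x).mul (continuous_dens r z)) (hMM z)).sub
    ((continuous_torusE_coupling G r L (continuous_dens r x) (hM x)).mul
      (continuous_torusE_coupling G r L (continuous_dens r z) (hM z)))

/-- **Integrated sum rule**: `∫_{β₁}^{β₂} Σ_z Cov_{T,γ}(A_x, A_z) dγ = E_{T,β₂}[A_x] − E_{T,β₁}[A_x]` (fundamental theorem of
calculus for the sum rule). [folklore] -/
theorem integral_sum_torusCov_dens_eq (L : ℕ) (x : Fin 4 → ℤ) (β₁ β₂ : ℝ) :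
    ∫ γ in β₁..β₂, ∑ z ∈ box 4 L, (torusE G r γ L (fun U => dens G r x U * dens G r z U) -
        torusE G r γ L (dens G r x) * torusE G r γ L (dens G r z)) =
      torusE G r β₂ L (dens G r x) - torusE G r β₁ L (dens G r x) :=
  intervalIntegral.integral_eq_sub_of_hasDerivAt (fun γ _ => hasDerivAt_torusE_dens_coupling G r γ L x)
    ((continuous_sum_torusCov_dens G r L x).intervalIntegrable _ _)

end Main

end Summit.QuantumFields.YangMills.Cruxes.NT.CouplingSumRule

end
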